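/-
Copyright (c) 2026 the pub-hodgecm-mathlib formalisation cell (harness21).  Prover seat hodgecm-mathlib-K2Liu-p08 (g7), Track B «K2-LIT»,
#184♮ = hLiu418 = `stmt-HodgeConjecture-24832`; #42S block D, row D-2, (σ-A) road ((σ-A) road desk K2Liu-p25 (g4) WORD #14 (3): the pin-readings brick),
FILE (W) «THE WEYL–LEVI LETTER OF [A1] AT THE NORMALISED IMPLEMENTER».  THEOREMS ONLY (no `def`, no `instance`, no `notation`, no named-fact hypothesis,
no `sorry`; default heartbeats except ONE measured rider `400000` on §2's main theorem).
-/
import Literature.NumberTheory.GelbartRogawski1991.LocalDoubledWeylElementCayleyMover   -- ★ `transportSp_cayleyMover_conj_iotaD_weylDelta` (pure Cayley mover)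
import HarnessLib

/-!
# Crux `HLiu418`, #42S block D row D-2, (σ-A) brick (pin readings) FILE (W) `K2LiuNormalisedWeylLeviLetter`:
# THE LEVI LETTER `B₁` OF [A1]'s `hW₁` AT THE NORMALISED IMPLEMENTER `π(p̂) = tS(m(Q)·κ)` IS `B = Q⁻ᵀ · j · Q⁻¹ = e₂ (0, −2𝔾; 2𝔾, 0) e₂`

Cell `hodgecm-mathlib`, crux item hLiu418 = `stmt-HodgeConjecture-24832`; lane `--supports stmt-HodgeConjecture-24832 --as helper` (count-neutral helper).

WHY.  ★ [A1] `K2LiuLocalSWCornerActionWordsYStage.exists_ne_zero_swSectionTensorLoc_weylTwo_uLongTwo_mul_eq_integral` (and the whole (C) inner stage of the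
(σ-A) telescope, ★ p865053 ∕ ★ p865218 ∕ ★ p865414) carries the Weyl element of the first block through its implementer `p₁` by ONE by-value letter
`hW₁ : π(p₁) · ι(w_Δ^{T₁}) · π(p₁)⁻¹ = (tS J)⁻¹ · tS(m(B₁))`, `B₁ ∈ GL_{M₂+M₂}(L⁺_v)` a BINDER; the phase of the inner stage is then read at the `B₁⁻¹`-twisted point
`u′ = (B₁⁻¹ t) ⊔ s` (★ p865218's split form).  The (2b) pin reading `hpinq` of ★ p865441 (K2Liu-p11's (D)) needs `B₁` EXPLICITLY.  At the NORMALISED implementer of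
record (desk ruling (N); ★ p865154 FILE B′, ★ K2Liu-p12 FILE B: `π(p̂) = transportSp 𝕋 (m(Q) · κ)`, `κ` the Cayley mover re-indexed along `e₂ ⊕ e₂`,
`Q⁻¹ = e₂ (2 ⊕ 𝔾) e₂`, `𝔾 = localGram T₀`) this file COMPUTES it:
* §1 (matrix algebra over any commutative ring): `J · m(Q) = (Q⁻ᵀ ⊕ Q) · J` (**`J_mul_coe_levi`**); for `B := Q⁻ᵀ · j · Q⁻¹`: `B⁻¹ = Q · j⁻¹ · Qᵀ`
  (**`coe_inv_of_eq_conj`**) and `(Q⁻ᵀ ⊕ Q) · m(j) = m(B) · m(Q)` (**`fromBlocks_mul_coe_levi_eq`**);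
* §2 **`transportSp_levi_mul_cayleyMover_conj_iotaD_weylDelta`** — for ANY Levi factor `Q`: `tS(m(Q)κ) · ι(w_Δ) · tS(m(Q)κ)⁻¹ = (tS J)⁻¹ · tS(m(Q⁻ᵀ j Q⁻¹))`,
  `j = e₂ (0, −1; 1, 0) e₂` the quarter turn of ★ `transportSp_cayleyMover_conj_iotaD_weylDelta` (that lemma is the case `Q = 1`; same proof, read on vectors,
  with the extra Levi factor moved across `J` by §1); and the by-name wrapper **`conj_iotaD_weylDelta_of_eq_transportSp`** taking `hP : P = tS(m(Q)κ)` (the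
  shape of FILE B's `hp₁`), whose conclusion is [A1]'s `hW₁` VERBATIM at `P`;
* §3 at the NORMALISED `Q`: **`conj_iotaD_weylDelta_normalised`** — `hW₁` holds with **`B = e₂ (0, −2𝔾; 2𝔾, 0) e₂`**, and **`coe_inv_normalisedLetter`** —
  **`B⁻¹ = e₂ (0, ½𝔾⁻¹; −½𝔾⁻¹, 0) e₂`**: the `B₁⁻¹`-twist is a SLOT SWAP (re-slot ← `½𝔾⁻¹`·im-slot, im-slot ← `−½𝔾⁻¹`·re-slot) — the reason the
  `𝓕`-variable of ★ p864884's Witt dictionary is slot-swapped (`τE j = ι t_{(j,1)} + ι t_{(j,0)}·δ′`).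
[cite: Kudla1994, §3] [cite: Weil1964, n° 32] [cite: MoeglinVignerasWaldspurger1987, Chap. 2 II.2]
HONEST LABEL.  Count-neutral helper; it retires the by-value letter `hW₁` at the normalised pair and feeds the pin brick (P) `K2LiuConePinReadingsOfRecord`; it
closes no socket by itself: `HC_CM` is proved only modulo the 7 printed citations (2 remaining named inputs: hLiu418 = `stmt-HodgeConjecture-24832`,
h413 = `stmt-HodgeConjecture-24833`) until rung 0 closes.

## References
* [Kudla1994] S. S. Kudla, *Splitting metaplectic covers of dual reductive pairs*, Israel J. Math. 87 (1994), §3.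
* [Weil1964] A. Weil, *Sur certains groupes d'opérateurs unitaires*, Acta Math. 111 (1964), n° 32.
* [MoeglinVignerasWaldspurger1987] C. Mœglin, M.-F. Vignéras, J.-L. Waldspurger, LNM 1291 (1987), Chap. 2 II.2.
-/

set_option autoImplicit false
set_option linter.dupNamespace false -- the mandated namespace repeats `HodgeConjecture.HodgeConjecture`

noncomputable section

open NumberField IsDedekindDomain Matrix
open Literature.RepresentationTheory.HeisenbergGroup Literature.RepresentationTheory.HeisenbergGroup.SymplecticMatrix
open Literature.NumberTheory.Automorphic Literature.NumberTheory.Automorphic.UnitaryGroup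
open Literature.NumberTheory.GelbartRogawski1991.UnitaryDualPair.LocalSplitting

namespace Summit.HodgeConjecture.HodgeConjecture.Cruxes.HLiu418.K2LiuNormalisedWeylLeviLetter

/-! ## §1 Matrix algebra: `J · m(Q) = (Q⁻ᵀ ⊕ Q) · J`, the letter `B = Q⁻ᵀ j Q⁻¹`, `(Q⁻ᵀ ⊕ Q) · m(j) = m(B) · m(Q)` -/

section Algebra

variable {K : Type*} [CommRing K] {ι : Type*} [Fintype ι] [DecidableEq ι]

/-- **`J · m(Q) = (Q⁻ᵀ ⊕ Q) · J`** (the Levi factor moves across Weil's `J`: `J m(Q) J⁻¹ = m(Q⁻ᵀ)`, written without inverses).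
[cite: MoeglinVignerasWaldspurger1987, Chap. 2 II.2] -/
theorem J_mul_coe_levi (Q : GL ι K) :
    Matrix.J ι K * ((levi Q : Matrix.symplecticGroup ι K) : Matrix (ι ⊕ ι) (ι ⊕ ι) K) =
      Matrix.fromBlocks ((Q⁻¹ : GL ι K) : Matrix ι ι K)ᵀ 0 0 (Q : Matrix ι ι K) * Matrix.J ι K := by
  rw [coe_levi, Matrix.J, Matrix.fromBlocks_multiply, Matrix.fromBlocks_multiply]
  simp only [Matrix.zero_mul, Matrix.mul_zero, Matrix.one_mul, Matrix.mul_one, Matrix.neg_mul, Matrix.mul_neg, Matrix.one_mul, zero_add,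
    add_zero, neg_zero]

/-- **the inverse of the letter `B = Q⁻ᵀ · j · Q⁻¹` is `Q · j⁻¹ · Qᵀ`**. [cite: Kudla1994, §3] -/
theorem coe_inv_of_eq_conj (Q j B : GL ι K)
    (hB : (B : Matrix ι ι K) = ((Q⁻¹ : GL ι K) : Matrix ι ι K)ᵀ * (j : Matrix ι ι K) * ((Q⁻¹ : GL ι K) : Matrix ι ι K)) :
    ((B⁻¹ : GL ι K) : Matrix ι ι K) = (Q : Matrix ι ι K) * ((j⁻¹ : GL ι K) : Matrix ι ι K) * (Q : Matrix ι ι K)ᵀ := by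
  apply Units.inv_eq_of_mul_eq_one_right
  rw [hB]
  calc ((Q⁻¹ : GL ι K) : Matrix ι ι K)ᵀ * (j : Matrix ι ι K) * ((Q⁻¹ : GL ι K) : Matrix ι ι K) *
        ((Q : Matrix ι ι K) * ((j⁻¹ : GL ι K) : Matrix ι ι K) * (Q : Matrix ι ι K)ᵀ)
      = ((Q⁻¹ : GL ι K) : Matrix ι ι K)ᵀ *
          ((j : Matrix ι ι K) * ((((Q⁻¹ : GL ι K) : Matrix ι ι K) * (Q : Matrix ι ι K)) * ((j⁻¹ : GL ι K) : Matrix ι ι K))) *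
            (Q : Matrix ι ι K)ᵀ := by
        simp only [Matrix.mul_assoc]
    _ = 1 := by
        rw [← Units.val_mul, inv_mul_cancel, Units.val_one, Matrix.one_mul, ← Units.val_mul, mul_inv_cancel, Units.val_one, Matrix.mul_one,
          ← Matrix.transpose_mul, ← Units.val_mul, mul_inv_cancel, Units.val_one, Matrix.transpose_one]

/-- **`(Q⁻ᵀ ⊕ Q) · m(j) = m(B) · m(Q)`** for `B = Q⁻ᵀ · j · Q⁻¹` (upper block `B Q = Q⁻ᵀ j`; lower block `B⁻ᵀ Q⁻ᵀ = Q j⁻ᵀ`).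
[cite: Kudla1994, §3] [cite: MoeglinVignerasWaldspurger1987, Chap. 2 II.2] -/
theorem fromBlocks_mul_coe_levi_eq (Q j B : GL ι K)
    (hB : (B : Matrix ι ι K) = ((Q⁻¹ : GL ι K) : Matrix ι ι K)ᵀ * (j : Matrix ι ι K) * ((Q⁻¹ : GL ι K) : Matrix ι ι K)) :
    Matrix.fromBlocks ((Q⁻¹ : GL ι K) : Matrix ι ι K)ᵀ 0 0 (Q : Matrix ι ι K) * ((levi j : Matrix.symplecticGroup ι K) : Matrix (ι ⊕ ι) (ι ⊕ ι) K) =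
      ((levi B : Matrix.symplecticGroup ι K) : Matrix (ι ⊕ ι) (ι ⊕ ι) K) * ((levi Q : Matrix.symplecticGroup ι K) : Matrix (ι ⊕ ι) (ι ⊕ ι) K) := by
  have hBinv := coe_inv_of_eq_conj Q j B hB
  rw [coe_levi, coe_levi, coe_levi, Matrix.fromBlocks_multiply, Matrix.fromBlocks_multiply]
  simp only [Matrix.zero_mul, Matrix.mul_zero, add_zero, zero_add]
  congr 1
  · rw [hB, Matrix.mul_assoc, ← Units.val_mul, inv_mul_cancel, Units.val_one, Matrix.mul_one]
  · rw [hBinv, Matrix.transpose_mul, Matrix.transpose_mul, Matrix.transpose_transpose, Matrix.mul_assoc, Matrix.mul_assoc, ← Matrix.transpose_mul,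
      ← Units.val_mul, inv_mul_cancel, Units.val_one, Matrix.transpose_one, Matrix.mul_one]

end Algebra

/-! ## §2 The Weyl element through the implementer `tS(m(Q) · κ)` — any Levi factor `Q` -/

variable (F : Type) [Field F] [NumberField F] (E : Type) [Field E] [NumberField E] [Algebra F E]
  [Algebra.IsQuadraticExtension F E] (c : E ≃ₐ[F] E)
  {δ : E} (hcδ : c δ = -δ) (hδ : δ ≠ 0) {d : F} (hd : δ * δ = algebraMap F E d)
  (v : HeightOneSpectrum (𝓞 F)) (n : ℕ) {T₀ : Matrix (Fin n) (Fin n) F} (hT₀ : T₀.IsSymm)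
  {JD : Matrix (Fin (n + n)) (Fin (n + n)) E} (hJD : JD = (gramD F n T₀).map (algebraMap F E))

set_option maxHeartbeats 400000 in -- MEASURED: 200000 ✗ (`whnf` timeout: the `Sp_{2(n+n)}` coercions in `hM` + the vector reading), 400000 ✓ (11.9 s wall)
include hT₀ hJD in
/-- **THE WEYL ELEMENT THROUGH `tS(m(Q) · κ)`**: for the re-indexed Cayley mover `κ` (★ `doublingCayley_mem`), ANY `Q ∈ GL_{n+n}(F_v)`, the quarter turn
`j = e₂ (0, −1; 1, 0) e₂` and `B` with `B = Q⁻ᵀ · j · Q⁻¹`: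
`tS(m(Q)κ) · ι^𝔻_v(w_Δ) · tS(m(Q)κ)⁻¹ = (tS J)⁻¹ · tS(m(B))` — ★ `transportSp_cayleyMover_conj_iotaD_weylDelta` is the case `Q = 1`; same proof read on vectors
(`ι^𝔻_v(w_Δ) = tS(m(ε))`, ★ `iotaD_weylDelta_eq_transportSp_levi`; the matrix identity `J · m(Q) · κ · m(ε) = m(B) · m(Q) · κ` from ★ `J_mul_doublingCayley_mul_sign` and §1).
[cite: Kudla1994, §3] [cite: Weil1964, n° 32] [cite: MoeglinVignerasWaldspurger1987, Chap. 2 II.2] -/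
theorem transportSp_levi_mul_cayleyMover_conj_iotaD_weylDelta [Invertible (2 : v.adicCompletion F)]
    (hTv : IsUnit (localGram F (n + n) (gramD F n T₀) v).det)
    (A : Matrix.symplecticGroup (Fin (n + n)) (v.adicCompletion F))
    (hA : (A : Matrix (Fin (n + n) ⊕ Fin (n + n)) (Fin (n + n) ⊕ Fin (n + n)) (v.adicCompletion F)) =
      Matrix.reindex ((e₂ n).sumCongr (e₂ n)) ((e₂ n).sumCongr (e₂ n))
        (Matrix.fromBlocks (Matrix.fromBlocks 1 (-1) 0 0)
            (Matrix.fromBlocks 0 0 ((⅟(2 : v.adicCompletion F)) • 1) ((⅟(2 : v.adicCompletion F)) • 1))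
            (Matrix.fromBlocks 0 0 (-1) (-1)) (Matrix.fromBlocks ((⅟(2 : v.adicCompletion F)) • 1) (-((⅟(2 : v.adicCompletion F)) • 1)) 0 0) :
          Matrix ((Fin n ⊕ Fin n) ⊕ (Fin n ⊕ Fin n)) ((Fin n ⊕ Fin n) ⊕ (Fin n ⊕ Fin n)) (v.adicCompletion F)))
    (j : GL (Fin (n + n)) (v.adicCompletion F))
    (hj : (j : Matrix (Fin (n + n)) (Fin (n + n)) (v.adicCompletion F)) = Matrix.reindex (e₂ n) (e₂ n) (Matrix.fromBlocks 0 (-1) 1 0))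
    (Q B : GL (Fin (n + n)) (v.adicCompletion F))
    (hB : (B : Matrix (Fin (n + n)) (Fin (n + n)) (v.adicCompletion F)) =
      ((Q⁻¹ : GL (Fin (n + n)) (v.adicCompletion F)) : Matrix (Fin (n + n)) (Fin (n + n)) (v.adicCompletion F))ᵀ *
        (j : Matrix (Fin (n + n)) (Fin (n + n)) (v.adicCompletion F)) *
        ((Q⁻¹ : GL (Fin (n + n)) (v.adicCompletion F)) : Matrix (Fin (n + n)) (Fin (n + n)) (v.adicCompletion F))) :
    transportSp (localGram F (n + n) (gramD F n T₀) v) hTv (levi Q * A) * iotaD F E c hcδ hδ hd v n hT₀ hJD (weylDelta F E c v n hJD) *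
        (transportSp (localGram F (n + n) (gramD F n T₀) v) hTv (levi Q * A))⁻¹ =
      (transportSp (localGram F (n + n) (gramD F n T₀) v) hTv (SymplecticGroup.symJ _ _))⁻¹ *
        transportSp (localGram F (n + n) (gramD F n T₀) v) hTv (levi B) := by
  -- the sign element `ε` (`ε⁻¹ = ε = εᵀ`), as in ★ `transportSp_cayleyMover_conj_iotaD_weylDelta`
  have hεε : Matrix.reindex (e₂ n) (e₂ n) (Matrix.fromBlocks 1 0 0 (-1) : Matrix (Fin n ⊕ Fin n) (Fin n ⊕ Fin n) (v.adicCompletion F)) *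
      Matrix.reindex (e₂ n) (e₂ n) (Matrix.fromBlocks 1 0 0 (-1)) = 1 := by
    rw [Matrix.reindex_apply, Matrix.submatrix_mul_equiv, Matrix.fromBlocks_multiply]
    simp only [Matrix.mul_one, Matrix.mul_zero, Matrix.mul_neg, neg_neg, neg_zero, add_zero, zero_add, Matrix.fromBlocks_one,
      Matrix.submatrix_one_equiv]
  obtain ⟨ε, hε⟩ : ∃ ε : GL (Fin (n + n)) (v.adicCompletion F),
      (ε : Matrix (Fin (n + n)) (Fin (n + n)) (v.adicCompletion F)) = Matrix.reindex (e₂ n) (e₂ n) (Matrix.fromBlocks 1 0 0 (-1)) :=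
    ⟨⟨_, _, hεε, hεε⟩, rfl⟩
  have hεinvT : ((ε⁻¹ : GL (Fin (n + n)) (v.adicCompletion F)) : Matrix (Fin (n + n)) (Fin (n + n)) (v.adicCompletion F))ᵀ =
      Matrix.reindex (e₂ n) (e₂ n) (Matrix.fromBlocks 1 0 0 (-1)) := by
    rw [Units.inv_eq_of_mul_eq_one_right (show (ε : Matrix (Fin (n + n)) (Fin (n + n)) (v.adicCompletion F)) *
      Matrix.reindex (e₂ n) (e₂ n) (Matrix.fromBlocks 1 0 0 (-1)) = 1 by rw [hε, hεε])]
    simp only [Matrix.transpose_reindex, Matrix.fromBlocks_transpose, Matrix.transpose_one, Matrix.transpose_zero, Matrix.transpose_neg]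
  -- the quarter turn `j` (`j⁻¹ = jᵀ`)
  have hjj : (j : Matrix (Fin (n + n)) (Fin (n + n)) (v.adicCompletion F)) * Matrix.reindex (e₂ n) (e₂ n) (Matrix.fromBlocks 0 1 (-1) 0) = 1 := by
    rw [hj, Matrix.reindex_apply, Matrix.reindex_apply, Matrix.submatrix_mul_equiv, Matrix.fromBlocks_multiply]
    simp only [Matrix.mul_one, Matrix.mul_zero, Matrix.mul_neg, neg_neg, neg_zero, add_zero, zero_add, Matrix.fromBlocks_one,
      Matrix.submatrix_one_equiv]
  have hjinvT : ((j⁻¹ : GL (Fin (n + n)) (v.adicCompletion F)) : Matrix (Fin (n + n)) (Fin (n + n)) (v.adicCompletion F))ᵀ =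
      Matrix.reindex (e₂ n) (e₂ n) (Matrix.fromBlocks 0 (-1) 1 0) := by
    rw [Units.inv_eq_of_mul_eq_one_right hjj]
    simp only [Matrix.transpose_reindex, Matrix.fromBlocks_transpose, Matrix.transpose_one, Matrix.transpose_zero, Matrix.transpose_neg]
  -- the matrix identity `J · κ · m(ε) = m(j) · κ`, re-indexed (★ `J_mul_doublingCayley_mul_sign`)
  have hM₀ : Matrix.J (Fin (n + n)) (v.adicCompletion F) *
        ((A : Matrix (Fin (n + n) ⊕ Fin (n + n)) (Fin (n + n) ⊕ Fin (n + n)) (v.adicCompletion F)) *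
          ((levi ε : Matrix.symplecticGroup (Fin (n + n)) (v.adicCompletion F)) :
            Matrix (Fin (n + n) ⊕ Fin (n + n)) (Fin (n + n) ⊕ Fin (n + n)) (v.adicCompletion F))) =
      ((levi j : Matrix.symplecticGroup (Fin (n + n)) (v.adicCompletion F)) :
          Matrix (Fin (n + n) ⊕ Fin (n + n)) (Fin (n + n) ⊕ Fin (n + n)) (v.adicCompletion F)) *
        (A : Matrix (Fin (n + n) ⊕ Fin (n + n)) (Fin (n + n) ⊕ Fin (n + n)) (v.adicCompletion F)) := by
    rw [coe_levi, coe_levi, hA, hε, hεinvT, hj, hjinvT, fromBlocks_reindex_zero_zero_reindex, fromBlocks_reindex_zero_zero_reindex,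
      ← reindex_sumCongr_J (e₂ n) (v.adicCompletion F), Matrix.reindex_apply, Matrix.reindex_apply, Matrix.reindex_apply,
      Matrix.reindex_apply, Matrix.submatrix_mul_equiv, Matrix.submatrix_mul_equiv, Matrix.submatrix_mul_equiv, ← Matrix.mul_assoc,
      J_mul_doublingCayley_mul_sign]
  -- with the Levi factor: `J · m(Q) · κ · m(ε) = (Q⁻ᵀ ⊕ Q) · J · κ · m(ε) = (Q⁻ᵀ ⊕ Q) · m(j) · κ = m(B) · m(Q) · κ` (§1)
  have hM : Matrix.J (Fin (n + n)) (v.adicCompletion F) *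
        (((levi Q * A : Matrix.symplecticGroup (Fin (n + n)) (v.adicCompletion F)) :
            Matrix (Fin (n + n) ⊕ Fin (n + n)) (Fin (n + n) ⊕ Fin (n + n)) (v.adicCompletion F)) *
          ((levi ε : Matrix.symplecticGroup (Fin (n + n)) (v.adicCompletion F)) :
            Matrix (Fin (n + n) ⊕ Fin (n + n)) (Fin (n + n) ⊕ Fin (n + n)) (v.adicCompletion F))) =
      ((levi B : Matrix.symplecticGroup (Fin (n + n)) (v.adicCompletion F)) :
          Matrix (Fin (n + n) ⊕ Fin (n + n)) (Fin (n + n) ⊕ Fin (n + n)) (v.adicCompletion F)) *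
        ((levi Q * A : Matrix.symplecticGroup (Fin (n + n)) (v.adicCompletion F)) :
            Matrix (Fin (n + n) ⊕ Fin (n + n)) (Fin (n + n) ⊕ Fin (n + n)) (v.adicCompletion F)) := by
    rw [Submonoid.coe_mul]
    calc Matrix.J (Fin (n + n)) (v.adicCompletion F) *
          (((levi Q : Matrix.symplecticGroup (Fin (n + n)) (v.adicCompletion F)) : Matrix _ _ (v.adicCompletion F)) *
              (A : Matrix _ _ (v.adicCompletion F)) *
            ((levi ε : Matrix.symplecticGroup (Fin (n + n)) (v.adicCompletion F)) : Matrix _ _ (v.adicCompletion F)))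
        = (Matrix.J (Fin (n + n)) (v.adicCompletion F) *
            ((levi Q : Matrix.symplecticGroup (Fin (n + n)) (v.adicCompletion F)) : Matrix _ _ (v.adicCompletion F))) *
            ((A : Matrix _ _ (v.adicCompletion F)) *
              ((levi ε : Matrix.symplecticGroup (Fin (n + n)) (v.adicCompletion F)) : Matrix _ _ (v.adicCompletion F))) := by
          simp only [Matrix.mul_assoc]
      _ = Matrix.fromBlocks ((Q⁻¹ : GL (Fin (n + n)) (v.adicCompletion F)) : Matrix _ _ (v.adicCompletion F))ᵀ 0 0
              (Q : Matrix _ _ (v.adicCompletion F)) *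
            (Matrix.J (Fin (n + n)) (v.adicCompletion F) *
              ((A : Matrix _ _ (v.adicCompletion F)) *
                ((levi ε : Matrix.symplecticGroup (Fin (n + n)) (v.adicCompletion F)) : Matrix _ _ (v.adicCompletion F)))) := by
          rw [J_mul_coe_levi, Matrix.mul_assoc]
      _ = Matrix.fromBlocks ((Q⁻¹ : GL (Fin (n + n)) (v.adicCompletion F)) : Matrix _ _ (v.adicCompletion F))ᵀ 0 0
              (Q : Matrix _ _ (v.adicCompletion F)) *
            ((levi j : Matrix.symplecticGroup (Fin (n + n)) (v.adicCompletion F)) : Matrix _ _ (v.adicCompletion F)) *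
            (A : Matrix _ _ (v.adicCompletion F)) := by
          rw [hM₀, Matrix.mul_assoc]
      _ = ((levi B : Matrix.symplecticGroup (Fin (n + n)) (v.adicCompletion F)) : Matrix _ _ (v.adicCompletion F)) *
            (((levi Q : Matrix.symplecticGroup (Fin (n + n)) (v.adicCompletion F)) : Matrix _ _ (v.adicCompletion F)) *
              (A : Matrix _ _ (v.adicCompletion F))) := by
          rw [fromBlocks_mul_coe_levi_eq Q j B hB, Matrix.mul_assoc]
  -- read on vectors `w = tS(m(Q)κ) w'` (no group algebra in `Sp_{2(n+n)}(F_v)` is needed)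
  rw [iotaD_weylDelta_eq_transportSp_levi F E c hcδ hδ hd v n hT₀ hJD hTv ε hε]
  apply Subtype.ext
  apply LinearEquiv.ext
  intro w
  obtain ⟨w', rfl⟩ := (transportSp (localGram F (n + n) (gramD F n T₀) v) hTv (levi Q * A)).1.surjective w
  simp only [Subgroup.coe_mul, Subgroup.coe_inv, LinearEquiv.mul_apply, LinearEquiv.coe_inv, LinearEquiv.symm_apply_apply]
  rw [LinearEquiv.eq_symm_apply]
  simp only [coe_transportSp_apply, LinearEquiv.apply_symm_apply, Matrix.mulVec_mulVec, SymplecticGroup.coe_J]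
  rw [hM]

include hT₀ hJD in
/-- **[A1]'s `hW₁` AT AN IMPLEMENTER OF CAYLEY–LEVI SHAPE, BY NAME**: if `P = tS(m(Q) · κ)` (FILE B's `hp₁`), then
`P · ι^𝔻_v(w_Δ) · P⁻¹ = (tS J)⁻¹ · tS(m(B))` with `B = Q⁻ᵀ · j · Q⁻¹` — the by-value letter `hW₁` of ★ [A1] ∕ ★ (C) with ITS `B₁` NAMED.
[cite: Kudla1994, §3] [cite: MoeglinVignerasWaldspurger1987, Chap. 2 II.2] -/
theorem conj_iotaD_weylDelta_of_eq_transportSp [Invertible (2 : v.adicCompletion F)]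
    (hTv : IsUnit (localGram F (n + n) (gramD F n T₀) v).det)
    (A : Matrix.symplecticGroup (Fin (n + n)) (v.adicCompletion F))
    (hA : (A : Matrix (Fin (n + n) ⊕ Fin (n + n)) (Fin (n + n) ⊕ Fin (n + n)) (v.adicCompletion F)) =
      Matrix.reindex ((e₂ n).sumCongr (e₂ n)) ((e₂ n).sumCongr (e₂ n))
        (Matrix.fromBlocks (Matrix.fromBlocks 1 (-1) 0 0)
            (Matrix.fromBlocks 0 0 ((⅟(2 : v.adicCompletion F)) • 1) ((⅟(2 : v.adicCompletion F)) • 1))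
            (Matrix.fromBlocks 0 0 (-1) (-1)) (Matrix.fromBlocks ((⅟(2 : v.adicCompletion F)) • 1) (-((⅟(2 : v.adicCompletion F)) • 1)) 0 0) :
          Matrix ((Fin n ⊕ Fin n) ⊕ (Fin n ⊕ Fin n)) ((Fin n ⊕ Fin n) ⊕ (Fin n ⊕ Fin n)) (v.adicCompletion F)))
    (j : GL (Fin (n + n)) (v.adicCompletion F))
    (hj : (j : Matrix (Fin (n + n)) (Fin (n + n)) (v.adicCompletion F)) = Matrix.reindex (e₂ n) (e₂ n) (Matrix.fromBlocks 0 (-1) 1 0))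
    (Q B : GL (Fin (n + n)) (v.adicCompletion F))
    (hB : (B : Matrix (Fin (n + n)) (Fin (n + n)) (v.adicCompletion F)) =
      ((Q⁻¹ : GL (Fin (n + n)) (v.adicCompletion F)) : Matrix (Fin (n + n)) (Fin (n + n)) (v.adicCompletion F))ᵀ *
        (j : Matrix (Fin (n + n)) (Fin (n + n)) (v.adicCompletion F)) *
        ((Q⁻¹ : GL (Fin (n + n)) (v.adicCompletion F)) : Matrix (Fin (n + n)) (Fin (n + n)) (v.adicCompletion F)))
    (P : LocalSp F (n + n) (gramD F n T₀) v) (hP : P = transportSp (localGram F (n + n) (gramD F n T₀) v) hTv (levi Q * A)) :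
    P * iotaD F E c hcδ hδ hd v n hT₀ hJD (weylDelta F E c v n hJD) * P⁻¹ =
      (transportSp (localGram F (n + n) (gramD F n T₀) v) hTv (SymplecticGroup.symJ _ _))⁻¹ *
        transportSp (localGram F (n + n) (gramD F n T₀) v) hTv (levi B) := by
  subst hP
  exact transportSp_levi_mul_cayleyMover_conj_iotaD_weylDelta F E c hcδ hδ hd v n hT₀ hJD hTv A hA j hj Q B hB

/-! ## §3 At the NORMALISED Levi factor `Q⁻¹ = e₂ (2 ⊕ 𝔾) e₂`: `B = e₂ (0, −2𝔾; 2𝔾, 0) e₂`, `B⁻¹ = e₂ (0, ½𝔾⁻¹; −½𝔾⁻¹, 0) e₂` -/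

include hT₀ in
/-- the letter at the normalised `Q`: `Q⁻ᵀ · j · Q⁻¹ = e₂ (0, −2𝔾; 2𝔾, 0) e₂` for `Q⁻¹ = e₂ (2 ⊕ 𝔾) e₂`, `𝔾 = localGram T₀` symmetric, `j = e₂ (0, −1; 1, 0) e₂`.
[cite: Kudla1994, §3] -/
theorem transpose_inv_mul_quarterTurn_mul_inv
    (j : GL (Fin (n + n)) (v.adicCompletion F))
    (hj : (j : Matrix (Fin (n + n)) (Fin (n + n)) (v.adicCompletion F)) = Matrix.reindex (e₂ n) (e₂ n) (Matrix.fromBlocks 0 (-1) 1 0))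
    (Q : GL (Fin (n + n)) (v.adicCompletion F))
    (hQ : ((Q⁻¹ : GL (Fin (n + n)) (v.adicCompletion F)) : Matrix (Fin (n + n)) (Fin (n + n)) (v.adicCompletion F)) =
      Matrix.reindex (e₂ n) (e₂ n) (Matrix.fromBlocks ((2 : v.adicCompletion F) • 1) 0 0 (localGram F n T₀ v))) :
    ((Q⁻¹ : GL (Fin (n + n)) (v.adicCompletion F)) : Matrix (Fin (n + n)) (Fin (n + n)) (v.adicCompletion F))ᵀ *
        (j : Matrix (Fin (n + n)) (Fin (n + n)) (v.adicCompletion F)) *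
        ((Q⁻¹ : GL (Fin (n + n)) (v.adicCompletion F)) : Matrix (Fin (n + n)) (Fin (n + n)) (v.adicCompletion F)) =
      Matrix.reindex (e₂ n) (e₂ n)
        (Matrix.fromBlocks 0 (-((2 : v.adicCompletion F) • localGram F n T₀ v)) ((2 : v.adicCompletion F) • localGram F n T₀ v) 0) := by
  have hGt : (localGram F n T₀ v)ᵀ = localGram F n T₀ v := by
    rw [localGram, ← Matrix.transpose_map, hT₀.eq]
  rw [hQ, hj, Matrix.transpose_reindex, Matrix.fromBlocks_transpose]
  simp only [Matrix.transpose_smul, Matrix.transpose_one, Matrix.transpose_zero, hGt, Matrix.reindex_apply, Matrix.submatrix_mul_equiv,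
    Matrix.fromBlocks_multiply, Matrix.zero_mul, Matrix.mul_zero, Matrix.mul_one, Matrix.mul_neg, Matrix.neg_mul, Matrix.smul_mul, Matrix.mul_smul,
    Matrix.one_mul, add_zero, zero_add, neg_zero, smul_zero]

include hT₀ hJD in
/-- **[A1]'s `hW₁` AT THE NORMALISED IMPLEMENTER, WITH ITS LETTER**: for `P = tS(m(Q) · κ)` with `Q⁻¹ = e₂ (2 ⊕ 𝔾) e₂` (`𝔾 = localGram T₀`; the normalised
implementer of record, desk ruling (N), FILE B's `hK₁ hQ₁ hp₁`) and `B = e₂ (0, −2𝔾; 2𝔾, 0) e₂`: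
`P · ι^𝔻_v(w_Δ) · P⁻¹ = (tS J)⁻¹ · tS(m(B))`. [cite: Kudla1994, §3] [cite: Weil1964, n° 32] [cite: MoeglinVignerasWaldspurger1987, Chap. 2 II.2] -/
theorem conj_iotaD_weylDelta_normalised [Invertible (2 : v.adicCompletion F)]
    (hTv : IsUnit (localGram F (n + n) (gramD F n T₀) v).det)
    (A : Matrix.symplecticGroup (Fin (n + n)) (v.adicCompletion F))
    (hA : (A : Matrix (Fin (n + n) ⊕ Fin (n + n)) (Fin (n + n) ⊕ Fin (n + n)) (v.adicCompletion F)) =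
      Matrix.reindex ((e₂ n).sumCongr (e₂ n)) ((e₂ n).sumCongr (e₂ n))
        (Matrix.fromBlocks (Matrix.fromBlocks 1 (-1) 0 0)
            (Matrix.fromBlocks 0 0 ((⅟(2 : v.adicCompletion F)) • 1) ((⅟(2 : v.adicCompletion F)) • 1))
            (Matrix.fromBlocks 0 0 (-1) (-1)) (Matrix.fromBlocks ((⅟(2 : v.adicCompletion F)) • 1) (-((⅟(2 : v.adicCompletion F)) • 1)) 0 0) :
          Matrix ((Fin n ⊕ Fin n) ⊕ (Fin n ⊕ Fin n)) ((Fin n ⊕ Fin n) ⊕ (Fin n ⊕ Fin n)) (v.adicCompletion F)))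
    (Q : GL (Fin (n + n)) (v.adicCompletion F))
    (hQ : ((Q⁻¹ : GL (Fin (n + n)) (v.adicCompletion F)) : Matrix (Fin (n + n)) (Fin (n + n)) (v.adicCompletion F)) =
      Matrix.reindex (e₂ n) (e₂ n) (Matrix.fromBlocks ((2 : v.adicCompletion F) • 1) 0 0 (localGram F n T₀ v)))
    (P : LocalSp F (n + n) (gramD F n T₀) v) (hP : P = transportSp (localGram F (n + n) (gramD F n T₀) v) hTv (levi Q * A))
    (B : GL (Fin (n + n)) (v.adicCompletion F))
    (hB : (B : Matrix (Fin (n + n)) (Fin (n + n)) (v.adicCompletion F)) =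
      Matrix.reindex (e₂ n) (e₂ n)
        (Matrix.fromBlocks 0 (-((2 : v.adicCompletion F) • localGram F n T₀ v)) ((2 : v.adicCompletion F) • localGram F n T₀ v) 0)) :
    P * iotaD F E c hcδ hδ hd v n hT₀ hJD (weylDelta F E c v n hJD) * P⁻¹ =
      (transportSp (localGram F (n + n) (gramD F n T₀) v) hTv (SymplecticGroup.symJ _ _))⁻¹ *
        transportSp (localGram F (n + n) (gramD F n T₀) v) hTv (levi B) := by
  -- the quarter turn as a `GL` element (`j⁻¹ = jᵀ`)
  have hjj : Matrix.reindex (e₂ n) (e₂ n) (Matrix.fromBlocks 0 (-1) 1 0 : Matrix (Fin n ⊕ Fin n) (Fin n ⊕ Fin n) (v.adicCompletion F)) *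
      Matrix.reindex (e₂ n) (e₂ n) (Matrix.fromBlocks 0 1 (-1) 0) = 1 := by
    rw [Matrix.reindex_apply, Matrix.reindex_apply, Matrix.submatrix_mul_equiv, Matrix.fromBlocks_multiply]
    simp only [Matrix.mul_one, Matrix.mul_zero, Matrix.mul_neg, neg_neg, neg_zero, add_zero, zero_add, Matrix.fromBlocks_one,
      Matrix.submatrix_one_equiv]
  have hjj' : Matrix.reindex (e₂ n) (e₂ n) (Matrix.fromBlocks 0 1 (-1) 0 : Matrix (Fin n ⊕ Fin n) (Fin n ⊕ Fin n) (v.adicCompletion F)) *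
      Matrix.reindex (e₂ n) (e₂ n) (Matrix.fromBlocks 0 (-1) 1 0) = 1 := by
    rw [Matrix.reindex_apply, Matrix.reindex_apply, Matrix.submatrix_mul_equiv, Matrix.fromBlocks_multiply]
    simp only [Matrix.mul_one, Matrix.mul_zero, Matrix.mul_neg, neg_neg, neg_zero, add_zero, zero_add, Matrix.fromBlocks_one,
      Matrix.submatrix_one_equiv]
  refine conj_iotaD_weylDelta_of_eq_transportSp F E c hcδ hδ hd v n hT₀ hJD hTv A hA
    ⟨Matrix.reindex (e₂ n) (e₂ n) (Matrix.fromBlocks 0 (-1) 1 0), Matrix.reindex (e₂ n) (e₂ n) (Matrix.fromBlocks 0 1 (-1) 0), hjj, hjj'⟩ rfl Q B ?_ P hP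
  rw [hB]
  exact (transpose_inv_mul_quarterTurn_mul_inv F v n hT₀ _ rfl Q hQ).symm

/-- **THE INVERSE OF THE NORMALISED LETTER IS A SLOT SWAP**: `B = e₂ (0, −2𝔾; 2𝔾, 0) e₂` ⇒ `B⁻¹ = e₂ (0, ½𝔾⁻¹; −½𝔾⁻¹, 0) e₂` (`𝔾` invertible) — so
`(B⁻¹ t)_{e₂(inl k)} = ½ (𝔾⁻¹ t_{inr})_k` and `(B⁻¹ t)_{e₂(inr k)} = −½ (𝔾⁻¹ t_{inl})_k`. [cite: Kudla1994, §3] -/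
theorem coe_inv_normalisedLetter [Invertible (2 : v.adicCompletion F)] (hG : IsUnit (localGram F n T₀ v).det)
    (B : GL (Fin (n + n)) (v.adicCompletion F))
    (hB : (B : Matrix (Fin (n + n)) (Fin (n + n)) (v.adicCompletion F)) =
      Matrix.reindex (e₂ n) (e₂ n)
        (Matrix.fromBlocks 0 (-((2 : v.adicCompletion F) • localGram F n T₀ v)) ((2 : v.adicCompletion F) • localGram F n T₀ v) 0)) :
    ((B⁻¹ : GL (Fin (n + n)) (v.adicCompletion F)) : Matrix (Fin (n + n)) (Fin (n + n)) (v.adicCompletion F)) =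
      Matrix.reindex (e₂ n) (e₂ n)
        (Matrix.fromBlocks 0 ((⅟(2 : v.adicCompletion F)) • (localGram F n T₀ v)⁻¹) (-((⅟(2 : v.adicCompletion F)) • (localGram F n T₀ v)⁻¹)) 0) := by
  apply Units.inv_eq_of_mul_eq_one_right
  rw [hB, Matrix.reindex_apply, Matrix.reindex_apply, Matrix.submatrix_mul_equiv, Matrix.fromBlocks_multiply]
  have h2 : ⅟(2 : v.adicCompletion F) * 2 = 1 := invOf_mul_self _
  simp only [Matrix.zero_mul, Matrix.mul_zero, add_zero, zero_add, Matrix.smul_mul, Matrix.mul_smul, Matrix.mul_neg, Matrix.neg_mul, smul_neg,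
    neg_neg, smul_smul, h2, one_smul, smul_zero, neg_zero, Matrix.mul_nonsing_inv _ hG, Matrix.fromBlocks_one, Matrix.submatrix_one_equiv]

/-- the two coordinate rows of the slot swap: for `t : Fin (n+n) → F_v`,
`(B⁻¹ t) (e₂ (inl k)) = ⅟2 · (𝔾⁻¹ *ᵥ (t ∘ e₂ ∘ inr)) k` and `(B⁻¹ t) (e₂ (inr k)) = −(⅟2 · (𝔾⁻¹ *ᵥ (t ∘ e₂ ∘ inl)) k)`. [cite: Kudla1994, §3] -/
theorem inv_normalisedLetter_mulVec_apply [Invertible (2 : v.adicCompletion F)] (hG : IsUnit (localGram F n T₀ v).det)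
    (B : GL (Fin (n + n)) (v.adicCompletion F))
    (hB : (B : Matrix (Fin (n + n)) (Fin (n + n)) (v.adicCompletion F)) =
      Matrix.reindex (e₂ n) (e₂ n)
        (Matrix.fromBlocks 0 (-((2 : v.adicCompletion F) • localGram F n T₀ v)) ((2 : v.adicCompletion F) • localGram F n T₀ v) 0))
    (t : Fin (n + n) → v.adicCompletion F) (k : Fin n) :
    (((B⁻¹ : GL (Fin (n + n)) (v.adicCompletion F)) : Matrix (Fin (n + n)) (Fin (n + n)) (v.adicCompletion F)) *ᵥ t) (e₂ n (Sum.inl k)) =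
        ⅟(2 : v.adicCompletion F) * ((localGram F n T₀ v)⁻¹ *ᵥ fun l => t (e₂ n (Sum.inr l))) k ∧
      (((B⁻¹ : GL (Fin (n + n)) (v.adicCompletion F)) : Matrix (Fin (n + n)) (Fin (n + n)) (v.adicCompletion F)) *ᵥ t) (e₂ n (Sum.inr k)) =
        -(⅟(2 : v.adicCompletion F) * ((localGram F n T₀ v)⁻¹ *ᵥ fun l => t (e₂ n (Sum.inl l))) k) := by
  have ht : t = (Sum.elim (fun l => t (e₂ n (Sum.inl l))) (fun l => t (e₂ n (Sum.inr l)))) ∘ (e₂ n).symm := by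
    funext i
    obtain ⟨s, rfl⟩ := (e₂ n).surjective i
    rcases s with l | l <;> simp only [Function.comp_apply, Equiv.symm_apply_apply, Sum.elim_inl, Sum.elim_inr]
  rw [coe_inv_normalisedLetter F v n hG B hB, ht, Matrix.reindex_apply, Matrix.submatrix_mulVec_equiv, Equiv.symm_symm, Function.comp_assoc,
    Equiv.symm_comp_self, Function.comp_id, Matrix.fromBlocks_mulVec]
  constructor <;>
    simp only [Function.comp_apply, Equiv.symm_apply_apply, Sum.elim_inl, Sum.elim_inr, Sum.elim_comp_inl, Sum.elim_comp_inr, Matrix.zero_mulVec,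
      zero_add, add_zero, Matrix.smul_mulVec, Matrix.neg_mulVec, Pi.smul_apply, Pi.neg_apply, smul_eq_mul]

end Summit.HodgeConjecture.HodgeConjecture.Cruxes.HLiu418.K2LiuNormalisedWeylLeviLetter

end
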